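import Summits.BirchSwinnertonDyer.Rank1Residual.X11b.RouteR1BDPExists
import Summits.BirchSwinnertonDyer.Rank1Residual.X11b.HalvesReceptacle
import Literature.FieldTheory.AlgClosed.PadicAlgClEquivComplex
import HarnessLib

/-!
# Route `ErratumRoadFive`, crux `OpenInputNotRam` (item stmt-BirchSwinnertonDyer-19282), registered
# stub `stub_bdpDatumNotRam` (H1′ at `p ∥ N` on the (¬ram) atom: an `R₀`-frame EXISTS) — FROM PRINT
# ON THE SEMISTABLE (¬ram) PAIRS: Castella, Camb. J. Math. 6 (2018) Thm. 3.1

Cell `bsd-stepL` (run/shared/lean/pub/bsd-stepL/), seat `bsd-stepL-nram2` (prover, PART 1b residue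
fan-out, 2026-08-26), `--supports stmt-BirchSwinnertonDyer-19282`. The registered BC3 skeleton
`Cruxes/OpenInputNotRam/Lines/birth.lean` (planner g25, sha16 b078920a0adb81b4) composes four mechanism
stubs into the crux by `OpenInputNotRam_of`; its second stub `stub_bdpDatumNotRam` (H1′) asks, at
every classical X11b datum of a (¬ram) pair (`p ≥ 5`, `ρ̄_{E,p}` onto, `K` an odd-discriminant strict
Heegner field, a parametrisation datum `Dt`, the Heegner point `P`, anticyclotomic `(κ, γ)`, a
degree-one prime `𝔭 ∋ p`), for a BDP frame in Castella's normalisation: a newform `f` of `E`, an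
embedding datum `ι' : ℚ̄_p ≃ ℂ` inducing `𝔭`, CM periods `Ω_K ≠ 0`, `Ω_p ∈ R₀ˣ` and `L ∈ R₀⟦T⟧ =
Λ_{R₀}` with the interpolation property `IsBDPLFunction ι' 𝔭 κ γ f Ω_K Ω_p L`.

HONEST FRAMING: BSD is NOT proved by any of this; a closed item closes a rung leaf (K2), never summit
credit; X11b stays CONSTRUCTION-SHAPED. THEOREMS ONLY (no definition, no named fact, no `sorry`);
CONDITIONAL on the ONE PUBLISHED named fact it lists — A206 `castella2018_exists_isBDPLFunction`
(Castella 2018 Thm. 3.1: `p ≥ 5`, SQUARE-FREE `N`, `ρ̄_{E,p}` irreducible, `K` imaginary quadratic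
with `p` split and (Heeg) in residue-degree-one form) — and therefore carrying the EXTRA binder
`Semistable W`: this file discharges H1′ on the SEMISTABLE (¬ram) pairs only. SCOPE NOTE (the typed
gap, nothing asserted): on the NON-semistable (¬ram) pairs (e.g. the BC5 rung `(6615d1, 5)`,
`N = 3³·5·7²`) the `Λ_{R₀}`-MEMBERSHIP of the BDP `p`-adic `L`-function at `p ∥ N` is not a printed
statement — Castella 2018 Thm. 3.1 stands under "`E` semistable" (§2.1), Castella–Hsieh 2018 Def. 3.5
needs `p ∤ N`, Castella JIMJ 17 (2018) Thms. 2.10–2.11 give a CONTINUOUS function on `Σ̂` (tree fact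
`thm210_thm211_bdpDisplay_pNew`, "nothing about `Λ_{R₀}`-membership"), and Hsieh 2014 Thm. A gives the
element over `Z̄_p ⊆ 𝓞_{ℂ_p}` (tree fact `hsieh2014_exists_anticyclotomicPAdicLFunction[_unrPeriod]`,
every odd `p` split, `p ∥ N` allowed, ANY `N`) — whose `R₀`-descent is, at `p = 3`, the cell's crux
`HsiehDescentAtThree` (closed there from BDP 2013's central-value reciprocity + the `𝒲^×`-period,
`Theorems/ClassRecordThreeHsiehDescentUnramifiedPeriodItems.lean`); the general-`p` port of that chain
is the door for the remaining pairs.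

Proof: `f := f_{Dt}` (`Dt.isNewformOf`); an embedding datum inducing `𝔭` exists
(`exists_datum_forall_mem_iff`: `𝔭` is `𝔭_{ι₀}` or `𝔭_{ι₀ ∘ conj}` for any `ι₀ : ℚ̄_p ≃ ℂ`,
`PadicAlgCl.nonempty_ringEquiv_complex`); it is `𝔭_{ι'}` at the unique infinite place
(`eq_primeOfEmbeddingDatum_of_forall_mem_iff`); the frame is A206 instantiated under the classical
Heegner hypothesis (`exists_isBDPLFunction_of_satisfiesHeegnerHypothesis`, multr1-p1: `p ∣ N` from
`Mult`, `Irr` from X11b, `p` split and (Heeg) from `SatisfiesHeegnerHypothesis`).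

* `openInputNotRam_stub_bdpDatumNotRam_of_castella2018_of_semistable` — the registered signature of
  `Cruxes.OpenInputNotRam.Birth.stub_bdpDatumNotRam` VERBATIM (fully qualified; the skeleton-local
  abbreviation `InducesPrimeAt p ι' 𝔭` written out as its body, definitionally equal), after the fact
  hypothesis `hBDP` and the extra binder `Semistable W`.

References: [Castella2018] Thm. 3.1 (arXiv:1704.06608 p. 9), §2.1 (p. 5); [CastellaHsieh2018] §3.3,
Def. 3.5, Prop. 3.6; [Hsieh2014] Thm. A (the ♭-frame beyond the semistable scope);
[Castella2018Exceptional] Thms. 2.10–2.11 (scope remark only).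
-/

set_option autoImplicit false
set_option linter.dupNamespace false

noncomputable section

open scoped Classical

open WeierstrassCurve NumberField IsDedekindDomain Field
open Literature.NumberTheory.EllipticCurves Literature.NumberTheory.EllipticCurves.ModularForms
  Literature.NumberTheory.EllipticCurves.Rank1Residual
  Literature.NumberTheory.GaloisRepresentations
open Summit.BirchSwinnertonDyer.Rank1Residual Summit.BirchSwinnertonDyer.Rank1Residual.X11b
  Summit.BirchSwinnertonDyer.Rank1Residual.X11b.AcSelmer
  Summit.BirchSwinnertonDyer.Rank1Residual.X11b.Halves

namespace Summit.BirchSwinnertonDyer.BirchSwinnertonDyer.Theorems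

/-- **Stub `stub_bdpDatumNotRam` of crux `OpenInputNotRam` (item 19282) FROM PRINT on the SEMISTABLE
(¬ram) pairs.** At every classical X11b datum of a semistable (¬ram) pair — the registered binders
VERBATIM plus `Semistable W` — there are a newform `f` of `E`, an embedding datum `ι'` inducing `𝔭`,
`Ω_K ≠ 0`, `Ω_p ∈ R₀ˣ` and `L ∈ R₀⟦T⟧` with `IsBDPLFunction ι' 𝔭 κ γ f Ω_K Ω_p L`: `f = f_{Dt}`,
`ι'` from `exists_datum_forall_mem_iff`, the frame from Castella 2018 Thm. 3.1
(`exists_isBDPLFunction_of_satisfiesHeegnerHypothesis`). CONDITIONAL on A206; the binders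
`¬ Ram W p`, `Odd d_K`, `¬ p ∣ d_K`, `¬ p ∣ #𝓞_K^×`, `L(E^{d_K},1) ≠ 0`, the point `P` are idle.
Nothing booked; the non-semistable (¬ram) pairs are NOT covered (module docstring).
[cite: Castella2018, Thm. 3.1 (arXiv:1704.06608 p. 9)]
[cite: CastellaHsieh2018, §3.3, Def. 3.5 and Prop. 3.6 (arXiv:1505.08165 pp. 9–11)] -/
theorem openInputNotRam_stub_bdpDatumNotRam_of_castella2018_of_semistable
    (hBDP : castella2018_exists_isBDPLFunction) :
    ∀ (W : WeierstrassCurve ℚ) [W.IsElliptic] [W.IsGloballyMinimal] (p : ℕ) [Fact p.Prime]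
      (N : ℕ) [NeZero N] (K : Type) [Field K] [NumberField K]
      (Dt : ModularParametrizationData W N) (H : HeegnerDatum N (NumberField.discr K)) (ι : K →+* ℂ)
      (P : (W.baseChange K).toAffine.Point), Semistable W →
      ¬ Literature.NumberTheory.EllipticCurves.Rank1Residual.Ram W p →
      ClassX11b W p → 5 ≤ p → Surj W p → W.conductorNorm ℤ = N → IsImaginaryQuadratic K →
      Odd (NumberField.discr K) → ¬ (p : ℤ) ∣ NumberField.discr K → ¬ p ∣ Units.torsionOrder K →
      SatisfiesHeegnerHypothesis N K →
      (W.quadraticTwist (NumberField.discr K : ℚ)).entireLFunction 1 ≠ 0 →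
      WeierstrassCurve.Affine.Point.map ι.toRatAlgHom P = heegnerPointComplex Dt H →
      ¬ (p : ℤ) ∣ Dt.c → ¬ IsOfFinAddOrder P →
      ∀ (κ : ZpExtension K p), κ.IsAnticyclotomic →
        ∀ (γ : Field.absoluteGaloisGroup K) [Fact (κ.IsTopGenerator γ)]
          (𝔭 : HeightOneSpectrum (𝓞 K)), ((p : ℕ) : 𝓞 K) ∈ 𝔭.asIdeal →
          𝔭.asIdeal.ramificationIdx (𝓞 ℚ) = 1 → 𝔭.asIdeal.inertiaDeg (𝓞 ℚ) = 1 →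
          ∃ (f : CuspForm (CongruenceSubgroup.Gamma0 N) 2), IsNewformOf W f ∧
            ∃ ι' : PadicAlgCl p ≃+* ℂ,
              (∀ (w : InfinitePlace K) (k : 𝓞 K),
                k ∈ 𝔭.asIdeal ↔ ‖ι'.symm (w.embedding (k : K))‖ < 1) ∧
              ∃ (ΩK : ℂ) (Ωp : (unrIntegers p)ˣ) (L : UnrSeries p),
                ΩK ≠ 0 ∧ IsBDPLFunction ι' 𝔭 κ γ f ΩK ((Ωp : unrIntegers p) : ℂ_[p]) L := by
  intro W _ _ p _ N _ K _ _ Dt H ιK P hss _hnr hX h5 _hs hN hK _hodd _hpd _hμ hHN _hLt _hP _hc _hPinf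
    κ hκ γ hγ 𝔭 h𝔭 he hf
  subst hN
  -- an embedding datum inducing `𝔭` (one of `ι₀`, `ι₀ ∘ conj`)
  obtain ⟨ι₀⟩ := PadicAlgCl.nonempty_ringEquiv_complex p
  obtain ⟨ι', -, hι'⟩ := exists_datum_forall_mem_iff p ι₀ hK h𝔭
  -- `𝔭` is the prime of `ι'` at the unique infinite place
  obtain ⟨w₀⟩ := (inferInstance : Nonempty (InfinitePlace K))
  obtain rfl : 𝔭 = primeOfEmbeddingDatum p ι' w₀.embedding :=
    eq_primeOfEmbeddingDatum_of_forall_mem_iff p ι' w₀.embedding (hι' w₀)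
  -- Castella 2018 Thm. 3.1 under the classical Heegner hypothesis (semistable pair)
  obtain ⟨ΩK, Ωp, L, hΩK, hL⟩ := exists_isBDPLFunction_of_satisfiesHeegnerHypothesis hBDP ι'
    Dt.isNewformOf h5 hss hX.2.2.2 (dvd_conductorNorm_of_mult hX.2.2.1) hK hHN κ hκ γ hγ.out w₀
  exact ⟨Dt.f, Dt.isNewformOf, ι', hι', ΩK, Ωp, L, hΩK, hL⟩

end Summit.BirchSwinnertonDyer.BirchSwinnertonDyer.Theorems

end
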